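import Literature.NumberTheory.GaloisRepresentations.SUnitsRestrictedLayersTransitions
import Literature.NumberTheory.GaloisRepresentations.RestrictedRamificationSUnitsLayerSupplyTwo
import Literature.NumberTheory.GaloisRepresentations.IdeleSUnitsCohomologyDegreeOneBound
import Literature.Algebra.Homology.DiscreteRepLayerColimitBoundedCofinal
import HarnessLib

/-!
# `H¹(U, E_S)` is FINITE, of order at most the class number of `F₀ = K̄^H`, for every open `U = H/N_S ≤ G_{K,S}`
# (Neukirch–Schmidt–Wingberg (8.3.11) (ii) `H¹(G_S(F₀), E_S) ≅ Cl_S(F₀)`, in the weak form `#H¹ ≤ h_{F₀}`)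

Topic `NumberTheory/GaloisRepresentations`; namespace `Literature.NumberTheory.GaloisRepresentations.SUnits.Layers`.
THEOREMS ONLY (no definition, no named fact, no `sorry`, no instance; D-0026).  Lane «TATE-EPC-TC» of cell `bsd-eis`
(crux `GoodLatticeBDPValue`, stmt-BirchSwinnertonDyer-19032; road memo `TATE-EPC-TC-ROAD-w5g7.md`, ROUTING #5 brick (F1b)),
on the way to the finiteness of `H²(G_{K,S}, μ_p)` (brick B1) in the kernel proof of Tate's global Euler–Poincaré
characteristic formula at totally complex `K`.

SETTING: `K` a number field, `S` a FINITE set of finite places of `K`, `H ≤ Γ_K` open with `N_S ≤ H`,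
`U := galoisGroupAbove S H = H/N_S` (open in `G_{K,S}`), `F₀ := baseField H = K̄^H` (a number field),
`E_S|_U := resRep K S H` (the `S`-units of `K_S = K̄^{N_S}` as a discrete `U`-module).

* §1 `numberField_baseField`: `F₀` is a number field.
* §2 **the layer bound** `finite_H1_layerRep_and_natCard_le`: for every finite Galois `E/K` with `F₀ ≤ E ⊆ K_S`,
  `H¹(↥U ⧸ Gal(K_S/E), (E_S|_U)^{Gal(K_S/E)})` is finite of order `≤ h_{F₀} = #Cl(𝒪_{F₀})` — it is
  `H¹(Gal(E/F₀), 𝒪_{E,S}ˣ)` ((A2-β2) `layerCohomologyIso`), i.e. `H¹(Gal(E/F₀), principal S₀-idèles)` (the bridge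
  `IdeleCohomology.sUnitsBridgeIso`, `S₀` = the places of `F₀` above `S`), which has order `≤ h_{F₀}` by (F1a)
  `IdeleCohomology.finite_H1_sUnitsIdeleRep_and_natCard_le` since `E/F₀` is unramified outside `S₀`
  (`isUnramifiedIn_of_le_of_ramificationSubgroup_le_galFixing`).
* §3 **`H¹(U, E_S)` is finite with `#H¹(U, E_S) ≤ h_{F₀}`** (`finite_continuousCohomology_one_resRep_and_natCard_le`,
  `finite_continuousCohomology_one_resRep`, `natCard_continuousCohomology_one_resRep_le`): the Galois-over-`K` layers
  `Gal(K_S/E)` are cofinal among the open normal subgroups of `U` ((A2-β1) `exists_layerSubgroup_le`) and uniformly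
  bounded (§2), so the colimit is finite of order `≤ h_{F₀}` (`DiscreteRepLayerColimitBoundedCofinal`).

HONEST FRAMING: an assembly of landed theorems (NSW (8.3.11) (ii) in the weak form `#H¹ ≤ h_{F₀}`, not the
isomorphism with `Cl_S(F₀)`); it proves no statement of a Summit, not Tate's formula, not the crux; 0 cells / labels /
tiers move.

## References
* J. Neukirch, A. Schmidt, K. Wingberg, *Cohomology of Number Fields*, 2nd ed. (2008), VIII §3 (8.3.11) (ii), (1.5.1),
  proof of (8.3.18)–(8.3.20). [NeukirchSchmidtWingberg2008]
* J.-P. Serre, *Cohomologie galoisienne* (1994), I §2.2 Prop. 8. [SerreGaloisCohomology1997]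
* D. Harari, *Galois Cohomology and Class Field Theory* (2020), Prop. 13.1, Lemma 15.39, §17.4 (17.1). [Harari2020]
* J. S. Milne, *Arithmetic Duality Theorems*, 2nd ed. (2006), I §4 (finiteness of `H²(G_S, μ_p)` via the `S`-units).
  [MilneADT2006]
-/

noncomputable section

open NumberField IsDedekindDomain Field Topology CategoryTheory
open Literature.NumberTheory.GaloisRepresentations.IdeleClassBar (GalLayer)
open Literature.NumberTheory.GaloisRepresentations.LocalWeilDatum (galFixing)
open Literature.NumberTheory.IwasawaTheory.Greenberg2006 (galoisGroupAbove)
open Literature.NumberTheory.GaloisRepresentations.OpenSubgroupLayer (algOfLE isScalarTower_algOfLE baseField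
  exists_layerSubgroup_le)
open Literature.Algebra.Homology Literature.Algebra.Homology.DiscreteRep

namespace Literature.NumberTheory.GaloisRepresentations

namespace SUnits

namespace Layers

variable {K : Type} [Field K] [NumberField K] (S : Set (HeightOneSpectrum (𝓞 K)))
  {H : Subgroup (absoluteGaloisGroup K)}

/-! ### §1. The base field `F₀ = K̄^H` is a number field -/

/-- **`F₀ = K̄^H` is a number field** for `H ≤ Γ_K` open containing `N_S`: it lies below a finite Galois layer
`E/K` of `K_S` ((A2-β1) `exists_layerSubgroup_le`). [cite: NeukirchANT1999, Ch. IV §1] -/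
theorem numberField_baseField (hHo : IsOpen (H : Set (absoluteGaloisGroup K))) (hNH : ramificationSubgroup K S ≤ H) :
    NumberField ↥(baseField H) := by
  obtain ⟨E, hF, -, -⟩ := exists_layerSubgroup_le S hHo hNH (⟨⊤, by simp⟩ : OpenNormalSubgroup ↥(galoisGroupAbove S H))
  haveI := E.finiteDimensional
  haveI : FiniteDimensional K ↥(baseField H) :=
    FiniteDimensional.of_injective (IntermediateField.inclusion hF).toLinearMap (IntermediateField.inclusion hF).injective
  exact NumberField.of_module_finite K _

variable {S}

/-! ### §2. The layer bound `#H¹(Gal(E/F₀), 𝒪_{E,S}ˣ) ≤ h_{F₀}` in door-c4's currency -/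

/-- **The layer `H¹(↥U ⧸ Gal(K_S/E), (E_S|_U)^{Gal(K_S/E)})` is finite of order `≤ h_{F₀}`** (`S` finite, `E/K` finite
Galois with `F₀ ≤ E ⊆ K_S`): it is `H¹(Gal(E/F₀), 𝒪_{E,S}ˣ) ≅ H¹(Gal(E/F₀), principal S₀-idèles)`, bounded by (F1a)
because `E/F₀` is unramified outside the places `S₀` of `F₀` above `S`.
[cite: NeukirchSchmidtWingberg2008, VIII §3 (8.3.11) (ii)] [cite: Harari2020, Lemma 15.39, Prop. 13.1] -/
theorem finite_H1_layerRep_and_natCard_le (hHo : IsOpen (H : Set (absoluteGaloisGroup K))) (hfin : S.Finite)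
    [NumberField ↥(baseField H)] (E : GalLayer K) (hF : baseField H ≤ E.1)
    (hS : ramificationSubgroup K S ≤ galFixing K E.1) :
    Finite (groupCohomology (layerRep hHo E hF hS) 1) ∧
      Nat.card (groupCohomology (layerRep hHo E hF hS) 1) ≤ Fintype.card (ClassGroup (𝓞 ↥(baseField H))) := by
  classical
  letI := algOfLE hF
  haveI := isScalarTower_algOfLE (K := K) hF
  haveI := E.finiteDimensional
  haveI := E.isGalois
  haveI : NumberField ↥E.1 := E.numberField
  haveI : IsGalois ↥(baseField H) ↥E.1 := IsGalois.tower_top_of_isGalois K ↥(baseField H) ↥E.1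
  -- the places of `F₀` above `S`, and unramifiedness of `E/F₀` outside them
  obtain ⟨S₀, hSF⟩ := exists_finset_mem_iff_under_mem S hfin ↥(baseField H)
  have hunr : ∀ v : HeightOneSpectrum (𝓞 ↥(baseField H)), v ∉ S₀ → Algebra.IsUnramifiedIn (𝓞 ↥E.1) v.asIdeal :=
    fun v hv => isUnramifiedIn_of_le_of_ramificationSubgroup_le_galFixing S hF hS v fun h => hv ((hSF v).2 h)
  -- (F1a) for the principal `S₀`-idèles of `E`
  obtain ⟨hfinite, hcard⟩ :=
    IdeleCohomology.finite_H1_sUnitsIdeleRep_and_natCard_le (F := ↥(baseField H)) (E := ↥E.1) S₀ hunr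
  -- `H¹(layer) ≅ H¹(Gal(E/F₀), 𝒪_{E,S}ˣ) ≅ H¹(Gal(E/F₀), principal S₀-idèles)`
  let e : groupCohomology (layerRep hHo E hF hS) 1 ≅
      groupCohomology (IdeleCohomology.sUnitsIdeleRep ↥(baseField H) ↥E.1 S₀) 1 :=
    layerCohomologyIso hHo E hF hS 1 ≪≫
      (groupCohomology.functor ℤ _ 1).mapIso (IdeleCohomology.sUnitsBridgeIso (K := K) (E := ↥E.1) S S₀ hSF)
  let ε := e.toLinearEquiv.toEquiv
  haveI := hfinite
  exact ⟨Finite.of_equiv _ ε.symm, (Nat.card_congr ε).trans_le hcard⟩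

/-! ### §3. `H¹(U, E_S)` is finite of order `≤ h_{F₀}` -/

/-- **`H¹(U, E_S)` is finite with `#H¹(U, E_S) ≤ h_{F₀}`** for `U = H/N_S ≤ G_{K,S}` open (`N_S ≤ H ≤ Γ_K` open),
`S` finite, `F₀ = K̄^H`: the finite Galois layers `Gal(K_S/E) ≤ U` are cofinal among the open normal subgroups of
`U` and each `H¹(Gal(E/F₀), 𝒪_{E,S}ˣ)` has order `≤ h_{F₀}`; `H¹(U, E_S)` is their directed union
(NSW (8.3.11) (ii): `H¹(G_S(F₀), E_S) ≅ Cl_S(F₀)`, weak form).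
[cite: NeukirchSchmidtWingberg2008, VIII §3 (8.3.11) (ii), (1.5.1)] [cite: SerreGaloisCohomology1997, I §2.2 Prop. 8] -/
theorem finite_continuousCohomology_one_resRep_and_natCard_le (hHo : IsOpen (H : Set (absoluteGaloisGroup K)))
    (hNH : ramificationSubgroup K S ≤ H) (hfin : S.Finite) [NumberField ↥(baseField H)] :
    Finite (continuousCohomology 1 (resRep K S H).toTopRep) ∧
      Nat.card (continuousCohomology 1 (resRep K S H).toTopRep) ≤ Fintype.card (ClassGroup (𝓞 ↥(baseField H))) := by
  haveI := compactSpace_above K S H hHo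
  haveI := totallyDisconnectedSpace_above (S := S) (H := H)
  have hlay : ∀ W : OpenNormalSubgroup ↥(galoisGroupAbove S H),
      ∃ V : OpenNormalSubgroup ↥(galoisGroupAbove S H), (V : Subgroup ↥(galoisGroupAbove S H)) ≤ W ∧
        ∀ t : Finset (groupCohomology ((invariantsQuotFunctor ℤ (V : Subgroup ↥(galoisGroupAbove S H))).obj
          (stdBase (resRep K S H).toTopRep (isDiscrete_resRep K S H))) 1),
          t.card ≤ Fintype.card (ClassGroup (𝓞 ↥(baseField H))) := by
    intro W
    obtain ⟨E, hF, hS, hle⟩ := exists_layerSubgroup_le S hHo hNH W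
    refine ⟨OpenSubgroupLayer.layerSubgroup S hHo E hF hS, hle, fun t => ?_⟩
    change Finset (groupCohomology (layerRep hHo E hF hS) 1) at t
    obtain ⟨hfinE, hcardE⟩ := finite_H1_layerRep_and_natCard_le hHo hfin E hF hS
    exact LayerColimit.finsetCard_le_of_finite_of_natCard_le hcardE t
  exact ⟨LayerColimit.finite_continuousCohomology_of_cofinal_layers (resRep K S H).toTopRep (isDiscrete_resRep K S H)
      1 _ hlay,
    LayerColimit.natCard_continuousCohomology_le_of_cofinal_layers (resRep K S H).toTopRep (isDiscrete_resRep K S H)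
      1 _ hlay⟩

/-- **`H¹(U, E_S)` is finite** (`U = H/N_S ≤ G_{K,S}` open, `S` finite).
[cite: NeukirchSchmidtWingberg2008, VIII §3 (8.3.11) (ii)] [cite: SerreGaloisCohomology1997, I §2.2 Prop. 8] -/
theorem finite_continuousCohomology_one_resRep (hHo : IsOpen (H : Set (absoluteGaloisGroup K)))
    (hNH : ramificationSubgroup K S ≤ H) (hfin : S.Finite) :
    Finite (continuousCohomology 1 (resRep K S H).toTopRep) :=
  haveI := numberField_baseField S hHo hNH
  (finite_continuousCohomology_one_resRep_and_natCard_le hHo hNH hfin).1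

/-- **`#H¹(U, E_S) ≤ h_{F₀}`**, `F₀ = K̄^H` (`U = H/N_S ≤ G_{K,S}` open, `S` finite).
[cite: NeukirchSchmidtWingberg2008, VIII §3 (8.3.11) (ii)] -/
theorem natCard_continuousCohomology_one_resRep_le (hHo : IsOpen (H : Set (absoluteGaloisGroup K)))
    (hNH : ramificationSubgroup K S ≤ H) (hfin : S.Finite) [NumberField ↥(baseField H)] :
    Nat.card (continuousCohomology 1 (resRep K S H).toTopRep) ≤ Fintype.card (ClassGroup (𝓞 ↥(baseField H))) :=
  (finite_continuousCohomology_one_resRep_and_natCard_le hHo hNH hfin).2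

end Layers

end SUnits

end Literature.NumberTheory.GaloisRepresentations

end
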